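import Literature.MathematicalPhysics.QuantumLattice.SectorisedEffectiveActionBoundPlateau
import Literature.MathematicalPhysics.QuantumLattice.GrassmannWeightedEffectiveActionRepresentation
import HarnessLib

/-!
# The DECAY-WEIGHTED sectorised single-scale step, plateau form (tree weights on the leg positions)

Topic `MathematicalPhysics/QuantumLattice`; sequel of `SectorisedEffectiveActionBoundPlateau` (the plateau identities:
inside any `F′`-measurement of the step, an arbitrary even input `G` may be replaced by the push-forward of its sector preimage)
and of `GrassmannWeightedEffectiveActionRepresentation` (`sum_wt_norm_kernel_map_effAction_le`: the decay-weighted single-scale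
step `V = map f Ṽ` read through an analysis map `g`, Benfatto–Giuliani–Mastropietro 2006 §2.8 with the decay bookkeeping of §3
(3.2)–(3.8)).  Here the two are combined for the Hubbard torus:

* `sum_wt_norm_kernel_presented_le` — the antisymmetrisation in `presented` costs nothing in WEIGHTED pinned sums whose weight
  is permutation invariant (generic);
* `sum_wt_norm_kernel_sectorPreimage_le` — the weighted pinned sums of the kernels of the sector preimage
  `Ṽ = sectorPreimage β F G` are `ε_x^{m+1}` times those of the SECTORISED kernels `kernel (map (toLin' E(F)) G)` (the currency of
  the engine's weighted invariants), for any weight of the leg label set;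
* **`sum_wt_norm_sectorAnalysis_effAction_le_of_plateau`** — the weighted step: families `F` (thin), `F̃` (fat, `F̃F = F`,
  `ΣF = 0 ⇒ F = 0`), output family `F′`, the plateau of `F` required only over the slice `C` and over `F′`; the sectorised slice
  `S(F̃)ᵀ C S(F̃)` in explicit Gram form with constant `κ` and WEIGHTED row/column sums `≤ α` (weight `wt{π X, π Y}` of the two leg
  positions); weighted input sizes `Σ_{Y_j = w} wt(π Y) ‖kernel (map (toLin' E(F)) G) (2m′) Y‖ ≤ B m′`; overlap constants
  `(cr, cc)` of `E(F′)·S(F̃)` against `wt{π″ X″, π X′}`; `θ = eα·normV κ ρ (m′ ↦ ε_x^{2m′} B m′)/κ² < 1` ⟹ `∫dμ_C e^{-G}` is a unit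
  and, in every degree `m + 1`, one output leg pinned,
  `Σ_{X″_p = w″} wt(π″ X″) ‖kernel (map (toLin' E(F′)) (effAction C G)) (m+1) X″‖ ≤ cr·cc^m·ρ^{-(m+1)}·e‖Ṽ‖_h/(1−θ)`.

Everything is proved; no definitions; no named facts.

## Sources

G. Benfatto, A. Giuliani, V. Mastropietro, Ann. Henri Poincaré 7 (2006) 809–898 = arXiv:cond-mat/0507686, §2.7 (2.70)–(2.71a),
§2.8 (2.76)–(2.83), §3 (3.2)–(3.8) [`BenfattoGiulianiMastropietro2006`]; M. Salmhofer, Commun. Math. Phys. 194 (1998) 249–295, §4.1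
[`Salmhofer1998`].
-/

noncomputable section

namespace Literature.MathematicalPhysics.QuantumLattice

open GrassmannAlgebra Finset Literature.Probability.LatticeModels Literature.Probability.LatticeModels.BattleFederbush
open scoped InnerProductSpace

/-! ### Antisymmetrisation costs nothing in permutation-invariant weighted pinned sums -/

section Presented

variable {𝕜 : Type*} [RCLike 𝕜] {Γ : Type*} [Fintype Γ] [DecidableEq Γ]

/-- **Weighted pinned sums of the kernel of a presented polynomial** (Salmhofer 1998 §4.1, no factorial: the `(m+1)!⁻¹` of the
antisymmetrisation compensates the `(m+1)!` permutations, each with the same weighted pinned sums when the weight is permutation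
invariant): if `Σ_{Z : Z_q = x} w(Z) ‖φ(Z)‖ ≤ B` for every pinned leg `q` and point `x`, then
`Σ_{X : X_p = x} w(X) ‖kernel (presented φ) (m+1) X‖ ≤ B`. [cite: Salmhofer1998, §4.1] -/
theorem sum_wt_norm_kernel_presented_le {m : ℕ} (φ : (Fin (m + 1) → Γ) → 𝕜) (w : (Fin (m + 1) → Γ) → ℝ)
    (hw0 : ∀ X, 0 ≤ w X) (hwσ : ∀ (X : Fin (m + 1) → Γ) (σ : Equiv.Perm (Fin (m + 1))), w (X ∘ σ) = w X) {B : ℝ}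
    (hB : ∀ (q : Fin (m + 1)) (x : Γ), ∑ Z ∈ univ.filter (fun Z : Fin (m + 1) → Γ => Z q = x), w Z * ‖φ Z‖ ≤ B)
    (p : Fin (m + 1)) (x : Γ) :
    ∑ X ∈ univ.filter (fun X : Fin (m + 1) → Γ => X p = x), w X * ‖kernel 𝕜 (presented 𝕜 φ) (m + 1) X‖ ≤ B := by
  -- `‖kernel‖ ≤ (m+1)!⁻¹ Σ_σ ‖φ(X ∘ σ)‖`
  have hpt : ∀ X : Fin (m + 1) → Γ, ‖kernel 𝕜 (presented 𝕜 φ) (m + 1) X‖ ≤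
      ((m + 1).factorial : ℝ)⁻¹ * ∑ σ : Equiv.Perm (Fin (m + 1)), ‖φ (X ∘ σ)‖ := by
    intro X
    rw [kernel_presented, norm_mul]
    have hfac : ‖(((m + 1).factorial : ℚ)⁻¹ • (1 : 𝕜))‖ = ((m + 1).factorial : ℝ)⁻¹ := by
      rw [Rat.smul_one_eq_cast, Rat.cast_inv, Rat.cast_natCast, norm_inv, RCLike.norm_natCast]
    rw [hfac]
    refine mul_le_mul_of_nonneg_left ((norm_sum_le _ _).trans (sum_le_sum fun σ _ => le_of_eq ?_)) (by positivity)
    rw [Units.smul_def, norm_smul]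
    rcases Int.units_eq_one_or (Equiv.Perm.sign σ) with h | h <;> simp [h]
  -- the weighted pinned sum of `X ↦ ‖φ (X ∘ σ)‖` is a weighted pinned sum of `φ` at the leg `σ⁻¹ p`
  have hperm : ∀ σ : Equiv.Perm (Fin (m + 1)),
      ∑ X ∈ univ.filter (fun X : Fin (m + 1) → Γ => X p = x), w X * ‖φ (X ∘ σ)‖ =
        ∑ Z ∈ univ.filter (fun Z : Fin (m + 1) → Γ => Z (σ.symm p) = x), w Z * ‖φ Z‖ := by
    intro σ
    have h := pinnedSum_comp_perm (𝕜 := ℝ) (fun X : Fin (m + 1) → Γ => w X * ‖φ X‖) σ p x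
    have hn : ∀ X : Fin (m + 1) → Γ, ‖w X * ‖φ X‖‖ = w X * ‖φ X‖ := fun X =>
      Real.norm_of_nonneg (mul_nonneg (hw0 X) (norm_nonneg _))
    simp only [hn] at h
    rw [← h]
    refine sum_congr rfl fun X _ => ?_
    rw [hwσ X σ]
  calc ∑ X ∈ univ.filter (fun X : Fin (m + 1) → Γ => X p = x), w X * ‖kernel 𝕜 (presented 𝕜 φ) (m + 1) X‖
      ≤ ∑ X ∈ univ.filter (fun X : Fin (m + 1) → Γ => X p = x),
          w X * (((m + 1).factorial : ℝ)⁻¹ * ∑ σ : Equiv.Perm (Fin (m + 1)), ‖φ (X ∘ σ)‖) :=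
        sum_le_sum fun X _ => mul_le_mul_of_nonneg_left (hpt X) (hw0 X)
    _ = ((m + 1).factorial : ℝ)⁻¹ * ∑ σ : Equiv.Perm (Fin (m + 1)),
          ∑ X ∈ univ.filter (fun X : Fin (m + 1) → Γ => X p = x), w X * ‖φ (X ∘ σ)‖ := by
        rw [sum_comm, mul_sum]
        refine sum_congr rfl fun X _ => ?_
        rw [mul_sum, mul_sum, mul_sum]
        exact sum_congr rfl fun σ _ => by ring
    _ = ((m + 1).factorial : ℝ)⁻¹ * ∑ σ : Equiv.Perm (Fin (m + 1)),
          ∑ Z ∈ univ.filter (fun Z : Fin (m + 1) → Γ => Z (σ.symm p) = x), w Z * ‖φ Z‖ := by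
        refine congrArg _ (sum_congr rfl fun σ _ => hperm σ)
    _ ≤ ((m + 1).factorial : ℝ)⁻¹ * ∑ _σ : Equiv.Perm (Fin (m + 1)), B :=
        mul_le_mul_of_nonneg_left (sum_le_sum fun σ _ => hB _ x) (by positivity)
    _ = B := by
        rw [sum_const, card_univ, Fintype.card_perm, Fintype.card_fin, nsmul_eq_mul, ← mul_assoc,
          inv_mul_cancel₀ (by positivity), one_mul]

end Presented

/-! ### The weighted pinned sums of the sector preimage in the sectorised currency -/

section Preimage

variable {L M : ℕ} [NeZero L] {N : ℕ} {Λ : Type*} [DecidableEq Λ]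

omit [NeZero L] in
/-- The leg set of a relabelled tuple is the leg set of the tuple. [folklore] -/
private theorem image_comp_perm_eq {α : Type*} [DecidableEq α] {m : ℕ} (X : Fin m → α) (σ : Equiv.Perm (Fin m)) :
    (univ : Finset (Fin m)).image (X ∘ σ) = univ.image X := by
  rw [← image_image, image_univ_of_surjective σ.surjective]

/-- **The weighted pinned sums of the kernels of the sector preimage are `ε_x^{m+1}` times those of the sectorised kernels**
`kernel (map (toLin' E(F)) G)`, for every weight of the leg label set (BGM 2006, (2.70)/(2.76): the preimage is presented by
`ε_x^{m+1}` times the sectorised kernels; antisymmetrisation is free). [cite: BenfattoGiulianiMastropietro2006, §2.8 (2.76)] -/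
theorem sum_wt_norm_kernel_sectorPreimage_le {β : ℝ} (hβ : 0 ≤ β) (F : Fin N → FreqMomentum L M → ℂ) (G : HubbardGrassmann L M)
    (wl : Finset (SpaceTimeIdx L M × SectorLeg N) → ℝ) (hwl : ∀ S, 0 ≤ wl S) {m : ℕ} {B : ℝ} (hB0 : 0 ≤ B)
    (hB : ∀ (q : Fin m) (w : SpaceTimeIdx L M × SectorLeg N),
      ∑ Y ∈ univ.filter (fun Y : Fin m → SpaceTimeIdx L M × SectorLeg N => Y q = w),
        wl (univ.image Y) * ‖kernel ℂ (ExteriorAlgebra.map (Matrix.toLin' (sectorAnalysisMatrix L M β F)) G) m Y‖ ≤ B)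
    (p : Fin m) (w : SpaceTimeIdx L M × SectorLeg N) :
    ∑ Y ∈ univ.filter (fun Y : Fin m → SpaceTimeIdx L M × SectorLeg N => Y p = w),
        ‖kernel ℂ (sectorPreimage β F G) m Y‖ * wl (univ.image Y) ≤ imagTimeWeight β M ^ m * B := by
  have hε : 0 ≤ imagTimeWeight β M := imagTimeWeight_nonneg hβ M
  cases m with
  | zero => exact p.elim0
  | succ m =>
  -- reorder the factors
  rw [show (∑ Y ∈ univ.filter (fun Y : Fin (m + 1) → SpaceTimeIdx L M × SectorLeg N => Y p = w),
      ‖kernel ℂ (sectorPreimage β F G) (m + 1) Y‖ * wl (univ.image Y)) =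
      ∑ Y ∈ univ.filter (fun Y : Fin (m + 1) → SpaceTimeIdx L M × SectorLeg N => Y p = w),
        wl (univ.image Y) * ‖kernel ℂ (sectorPreimage β F G) (m + 1) Y‖ from sum_congr rfl fun Y _ => mul_comm _ _]
  by_cases hm : m + 1 ≤ Fintype.card (HubbardFieldIdx L M)
  · -- the preimage is presented by `ε^{m+1}·(sectorised kernels)`
    set φ : (Fin (m + 1) → SpaceTimeIdx L M × SectorLeg N) → ℂ := fun Y =>
      ((imagTimeWeight β M : ℝ) : ℂ) ^ (m + 1) * sectorisedKernel L M β F G (m + 1) (fun i => (Y i).2) (fun i => (Y i).1) with hφ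
    have hk : ∀ Y, kernel ℂ (sectorPreimage β F G) (m + 1) Y = kernel ℂ (presented ℂ φ) (m + 1) Y := fun Y => by
      rw [kernel_sectorPreimage, if_pos hm]
    simp only [hk]
    refine sum_wt_norm_kernel_presented_le φ (fun Y => wl (univ.image Y)) (fun Y => hwl _)
      (fun Y σ => by simp only [image_comp_perm_eq]) (fun q x => ?_) p w
    -- the weighted pinned sums of `φ`
    have hφn : ∀ Y, ‖φ Y‖ = imagTimeWeight β M ^ (m + 1) *
        ‖kernel ℂ (ExteriorAlgebra.map (Matrix.toLin' (sectorAnalysisMatrix L M β F)) G) (m + 1) Y‖ := fun Y => by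
      rw [hφ, kernel_map_sectorAnalysis]
      dsimp only
      rw [norm_mul, norm_pow, Complex.norm_real, Real.norm_of_nonneg hε]
    simp only [hφn]
    calc ∑ Z ∈ univ.filter (fun Z : Fin (m + 1) → SpaceTimeIdx L M × SectorLeg N => Z q = x),
          wl (univ.image Z) * (imagTimeWeight β M ^ (m + 1) *
            ‖kernel ℂ (ExteriorAlgebra.map (Matrix.toLin' (sectorAnalysisMatrix L M β F)) G) (m + 1) Z‖)
        = imagTimeWeight β M ^ (m + 1) * ∑ Z ∈ univ.filter (fun Z : Fin (m + 1) → SpaceTimeIdx L M × SectorLeg N => Z q = x),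
            wl (univ.image Z) * ‖kernel ℂ (ExteriorAlgebra.map (Matrix.toLin' (sectorAnalysisMatrix L M β F)) G) (m + 1) Z‖ := by
          rw [mul_sum]
          exact sum_congr rfl fun Z _ => by ring
      _ ≤ imagTimeWeight β M ^ (m + 1) * B := mul_le_mul_of_nonneg_left (hB q x) (pow_nonneg hε _)
  · have hk : ∀ Y, kernel ℂ (sectorPreimage β F G) (m + 1) Y = 0 := fun Y => by
      rw [kernel_sectorPreimage, if_neg hm]
    simp only [hk, norm_zero, mul_zero, sum_const_zero]
    positivity

end Preimage

/-! ### The weighted sectorised step, plateau form -/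

section Step

variable {L M : ℕ} [NeZero L] [NeZero M] {N N' : ℕ} {Λ : Type*} [DecidableEq Λ] {wt : Finset Λ → ℝ}

/-- **The decay-weighted sectorised single-scale step, plateau form** (BGM 2006, (2.77) with (2.71a), (2.80)–(2.82), §3 (3.2)–(3.8)).
Data: a tree weight `wt` on the position sets and position maps `π` (input sector-field labels), `π″` (output labels); thin and fat input
families `F, F̃` (`F̃F = F`, `Σ_ω F_ω(k) = 0 ⇒ F_ω(k) = 0`); an output family `F′`; an even input `G` without constant part; a slice
covariance `C` with the plateau conditions (`Σ_ω F_ω = 1` on the momenta of `supp C` and of `supp F′`), whose sectorised propagator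
`C′ = S(F̃)ᵀ C S(F̃)` is charged (`q`), in Gram form (`fv, gv`, constant `κ`), with WEIGHTED row/column sums `Σ ‖C′(X,Y)‖·wt{π X, π Y} ≤ α`;
weighted input sizes `Σ_{Y_j = w} wt(π Y) ‖kernel (map (toLin' E(F)) G) (2m′) Y‖ ≤ B m′` (all labels, one leg pinned); a radius `ρ > 0` and
`θ = eα‖Ṽ‖_h/κ² < 1` with `‖Ṽ‖_h = normV κ ρ (m′ ↦ ε_x^{2m′} B m′)`; overlap constants `Σ ‖(E(F′)·S(F̃))(X″,X′)‖·wt{π″ X″, π X′} ≤ cr / cc`.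
THEN `∫dμ_C e^{-G}` is a unit and, in every degree `m + 1`, one output leg pinned,
`Σ_{X″_p = w″} wt(π″ X″) ‖kernel (map (toLin' E(F′)) (effAction C G)) (m+1) X″‖ ≤ cr·cc^m·ρ^{-(m+1)}·e‖Ṽ‖_h/(1−θ)`.
[cite: BenfattoGiulianiMastropietro2006, (2.77) with (2.71a), (2.80)-(2.82) and §3 (3.2)-(3.8)] -/
theorem sum_wt_norm_sectorAnalysis_effAction_le_of_plateau {E : Type*} [NormedAddCommGroup E] [InnerProductSpace ℂ E]
    (hwt : IsTreeWeight wt) (π : SpaceTimeIdx L M × SectorLeg N → Λ) (π'' : SpaceTimeIdx L M × SectorLeg N' → Λ)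
    {β : ℝ} (hβ : 0 < β) (F Ft : Fin N → FreqMomentum L M → ℂ) (hFF : ∀ ω k, Ft ω k * F ω k = F ω k)
    (hF0 : ∀ k, ∑ ω, F ω k = 0 → ∀ ω, F ω k = 0)
    (F' : Fin N' → FreqMomentum L M → ℂ) (G : HubbardGrassmann L M) (hG : G ∈ evenPart ℂ (HubbardFieldIdx L M))
    (hG0 : constPart ℂ G = 0)
    (C : Matrix (HubbardFieldIdx L M) (HubbardFieldIdx L M) ℂ)
    (hCpl : ∀ X Y, C X Y ≠ 0 → ∑ ω, F ω X.1.1 = 1 ∧ ∑ ω, F ω Y.1.1 = 1)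
    (hF'pl : ∀ (ω' : Fin N') (k : FreqMomentum L M), F' ω' k ≠ 0 → ∑ ω, F ω k = 1)
    (q : SpaceTimeIdx L M × SectorLeg N → Bool)
    (hC : ∀ X Y, q X = q Y → ((sectorSubMatrix L M β Ft).transpose * C * sectorSubMatrix L M β Ft) X Y = 0)
    (fv gv : SpaceTimeIdx L M × SectorLeg N → E) {κ : ℝ} (hκ : 0 < κ) (hf : ∀ X, q X = true → ‖fv X‖ ≤ κ)
    (hg : ∀ Y, q Y = false → ‖gv Y‖ ≤ κ)
    (hGram : ∀ X Y, q X = true → q Y = false →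
      contr ℂ ((sectorSubMatrix L M β Ft).transpose * C * sectorSubMatrix L M β Ft) X Y = ⟪fv X, gv Y⟫_ℂ)
    (B : ℕ → ℝ) (hB0 : ∀ m', 0 ≤ B m')
    (hB : ∀ (m' : ℕ) (j : Fin (2 * m')) (w : SpaceTimeIdx L M × SectorLeg N),
      ∑ Y ∈ univ.filter (fun Y : Fin (2 * m') → SpaceTimeIdx L M × SectorLeg N => Y j = w),
        wt ((univ.image Y).image π) * ‖kernel ℂ (ExteriorAlgebra.map (Matrix.toLin' (sectorAnalysisMatrix L M β F)) G) (2 * m') Y‖ ≤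
          B m')
    {α : ℝ} (hα : 0 < α)
    (hrow : ∀ X, ∑ Y, ‖((sectorSubMatrix L M β Ft).transpose * C * sectorSubMatrix L M β Ft) X Y‖ * wt {π X, π Y} ≤ α)
    (hcol : ∀ Y, ∑ X, ‖((sectorSubMatrix L M β Ft).transpose * C * sectorSubMatrix L M β Ft) X Y‖ * wt {π X, π Y} ≤ α)
    {ρ : ℝ} (hρ : 0 < ρ)
    (hθ : Real.exp 1 * α * normV (SpaceTimeIdx L M × SectorLeg N) κ ρ (fun m' => imagTimeWeight β M ^ (2 * m') * B m') / κ ^ 2 < 1)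
    {cr cc : ℝ} (hcc0 : 0 ≤ cc)
    (hrow' : ∀ X'', ∑ X', ‖(sectorAnalysisMatrix L M β F' * sectorSubMatrix L M β Ft) X'' X'‖ * wt {π'' X'', π X'} ≤ cr)
    (hcol' : ∀ X', ∑ X'', ‖(sectorAnalysisMatrix L M β F' * sectorSubMatrix L M β Ft) X'' X'‖ * wt {π'' X'', π X'} ≤ cc) :
    IsUnit (effPartitionFn ℂ C G) ∧ ∀ (m : ℕ) (p : Fin (m + 1)) (w'' : SpaceTimeIdx L M × SectorLeg N'),
      ∑ X'' ∈ univ.filter (fun X'' : Fin (m + 1) → SpaceTimeIdx L M × SectorLeg N' => X'' p = w''),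
          wt ((univ.image X'').image π'') *
            ‖kernel ℂ (ExteriorAlgebra.map (Matrix.toLin' (sectorAnalysisMatrix L M β F')) (effAction ℂ C G)) (m + 1) X''‖ ≤
        cr * cc ^ m * (ρ⁻¹ ^ (m + 1) *
          (Real.exp 1 * normV (SpaceTimeIdx L M × SectorLeg N) κ ρ (fun m' => imagTimeWeight β M ^ (2 * m') * B m')) /
          (1 - Real.exp 1 * α * normV (SpaceTimeIdx L M × SectorLeg N) κ ρ (fun m' => imagTimeWeight β M ^ (2 * m') * B m') /
            κ ^ 2)) := by
  have hε : 0 ≤ imagTimeWeight β M := imagTimeWeight_nonneg hβ.le M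
  -- the weighted pinned sums of the preimage's kernels
  have hwl : ∀ S : Finset (SpaceTimeIdx L M × SectorLeg N), 0 ≤ wt (S.image π) := fun S =>
    zero_le_one.trans (hwt.one_le _)
  have hN : ∀ (m' : ℕ) (j : Fin (2 * m')) (w : SpaceTimeIdx L M × SectorLeg N),
      ∑ Y ∈ univ.filter (fun Y : Fin (2 * m') → SpaceTimeIdx L M × SectorLeg N => Y j = w),
        ‖kernel ℂ (sectorPreimage β F G) (2 * m') Y‖ * wt ((univ.image Y).image π) ≤ imagTimeWeight β M ^ (2 * m') * B m' :=
    fun m' j w => sum_wt_norm_kernel_sectorPreimage_le hβ.le F G (fun S => wt (S.image π)) hwl (hB0 m') (hB m') j w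
  have hN0 : ∀ m', 0 ≤ imagTimeWeight β M ^ (2 * m') * B m' := fun m' => mul_nonneg (pow_nonneg hε _) (hB0 m')
  -- the weighted step for `Ṽ` in the representation `(S, E)`
  have h := sum_wt_norm_kernel_map_effAction_le hwt π π'' C (Matrix.toLin' (sectorSubMatrix L M β Ft))
    (Matrix.toLin' (sectorAnalysisMatrix L M β F')) (sectorPreimage β F G) (sectorPreimage_mem_evenPart β F hG)
    (by rw [constPart_sectorPreimage, hG0]) q (by simpa only [LinearMap.toMatrix'_toLin'] using hC) fv gv hκ hf hg
    (by simpa only [LinearMap.toMatrix'_toLin'] using hGram) (fun m' => imagTimeWeight β M ^ (2 * m') * B m') hN0 hN hα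
    (by simpa only [LinearMap.toMatrix'_toLin'] using hrow) (by simpa only [LinearMap.toMatrix'_toLin'] using hcol) hρ hθ hcc0
    (by simpa only [LinearMap.toMatrix'_toLin'] using hrow') (by simpa only [LinearMap.toMatrix'_toLin'] using hcol')
  -- transfer from `map S Ṽ` to `G` (plateau identities)
  rw [effPartitionFn_map_sectorSub_sectorPreimage_of_plateau hβ.ne' F Ft hFF hF0 G C hCpl] at h
  simp_rw [map_sectorAnalysis_effAction_map_sectorPreimage_of_plateau hβ.ne' F Ft hFF hF0 F' G C hCpl hF'pl] at h
  exact h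

end Step

end Literature.MathematicalPhysics.QuantumLattice

end
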